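import Literature.MathematicalPhysics.QuantumFieldTheory.Balaban1983to89.B13Contraction113

/-!
# T⁴ programme, node NE3, route P2 «ENERGY CONVEXITY» — leaf L2 (PATH), abstract layer: B11's LINEARISING MAP
# `Φ(A′) = A′ − H·D(A′)` from the tree's Prop-3 fixed point (`B13Contraction113`), the linearisation identity
# `N(Φ(A′)) = Q A′`, `Φ(0) = 0`, `‖Φ(A′) − A′‖ ≤ 4bC₂‖A′‖²`, and the analytic one-parameter path `σ ↦ Φ(σ•X₀)`

Eleventh generation of the NE3 prover lineage P2 (unit `b2b-balaban-t4-ne3-p2`; ROUND-2 SKELETON-FIRST mandate), leaf L2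
of `HOME/t4/skeletons/NE3-t4-ne3-p2.md` (v1.5), ABSTRACT layer.  The route's admissible path from the run-A minimiser to
the competitor `W` is B11's chart segment `t ↦ W·exp Φ_W((1−t)X₀)` ([Balaban1985Variational] (47) p. 285: «We will
construct the linearizing transformation in the form A = A′ − HD(A′)», D the fixed point of (49)–(50), Prop. 3 p. 289).
The b13 sub-cell's `B13Contraction113` already kernel-checks the fixed point `X = C(A′ − H X)` on the ball `4C₂ε²`
(`exists_unique_fixedPoint`), its bound (`bound_114`) and its HOLOMORPHIC dependence on a complex parameter
(`analytic_fixedPoint_113`) over abstract complex normed spaces.  THIS FILE adds the three lines of algebra the route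
needs on top (all [folklore]): with a constraint functional split `N A = Q A + C A` (`Q` linear = the linearised `k`-fold
average, `C` the quadratic remainder — B7 (122)–(123)∕(134)–(136) TYPE, a HYPOTHESIS here), a linear `Hop` with
`Q (Hop X) = X` (a right inverse; B11's `H` (45), or the tree's planted lift — a HYPOTHESIS here):
 * §1 `linearise_of_fixedPoint`: `C (A′ − Hop X) = X ⟹ N (A′ − Hop X) = Q A′` — THE LINEARISATION (48): in the chart
   coordinate `A′` the non-linear constraint `N = const` becomes the LINEAR one `Q A′ = const`, so the chart segment of
   two points of one fibre stays in the fibre (field `adm` of `NE3EnergyAssembly.RouteLeaves`);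
 * §2 `exists_linearising`: existence + uniqueness + `‖Φ(A′) − A′‖ ≤ b·4C₂‖A′‖²` packaged (`Φ(A′) := A′ − Hop X⋆`);
   `fixedPoint_zero` (`Φ(0) = 0`: the background itself is the chart origin);
 * §3 `exists_linearising_path`: for `A′_σ := σ•X₀` on the disc `‖σ‖ < ρ` (with `ρ‖X₀‖ ≤ ε`) the fixed point, hence
   `Φ(σ•X₀)`, is HOLOMORPHIC in `σ` (`analytic_fixedPoint_113` BY NAME) — so the real path `t ↦ Φ(tX₀)`, `t ∈ [0,1] ⊂`
   disc, is real-analytic: the source of fields `d1`∕`d2`∕`velocity` of `RouteLeaves` (Cauchy bounds on Γ′, Γ″ are the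
   typer's next step, tree `B13Contraction113.norm_sub_le_of_sphere_bound`).
What is NOT here (the two located inputs of L2 in the skeleton): (L2-i) a right inverse `Hop` bounded UNIFORMLY in `k`
for Bałaban's linearised `k`-fold average; (L2-ii) the `k`-uniform quadratic constant `C₂` (B7 Prop. 4 TYPE).

HONEST FRAMING.  Finite-T⁴ bookkeeping (rung (B)+1); abstract complex-Banach-space algebra on top of an accepted sibling
module; NOTHING about Bałaban's minimisers or his `H`, `C_k` is asserted; no conditional of the cell is used or hidden;
NOT infinite volume ∕ mass gap ∕ Clay ∕ summit progress; NE3 NOT proved.  ABSOLUTE RULE kept: no printed sentence is a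
hypothesis of a theorem (context: [Balaban1985Variational] (44)–(50) p. 285, (55)–(58) pp. 286–287, Prop. 3 p. 289).
PLACEMENT: `Summits/QuantumFields/BalabanUV/`; imports the accepted `Literature.….B13Contraction113` only; moves nothing.
-/

set_option autoImplicit false

open Metric Set

namespace Summit.QuantumFields.BalabanUV.T4Continuum.NE3Linearising

open Literature.MathematicalPhysics.QuantumFieldTheory.Balaban1983to89.B13Contraction113

noncomputable section

variable {𝒳 𝒴 : Type*} [NormedAddCommGroup 𝒳] [NormedSpace ℂ 𝒳] [NormedAddCommGroup 𝒴] [NormedSpace ℂ 𝒴]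

/-! ## §1 The linearisation identity (48) -/

/-- **THE LINEARISATION IDENTITY** (B11 (48)∕(49), abstract): if the constraint functional splits as `N = Q + C` with `Q`
additive and `Q (Hop X) = X` for all `X` (right inverse), then at a fixed point `X = C (A′ − Hop X)` the configuration
`A′ − Hop X` satisfies the LINEAR constraint: `N (A′ − Hop X) = Q A′`. [folklore] -/
theorem linearise_of_fixedPoint {N C : 𝒴 → 𝒳} {Q : 𝒴 →ₗ[ℂ] 𝒳} {Hop : 𝒳 →ₗ[ℂ] 𝒴}
    (hN : ∀ A, N A = Q A + C A) (hQH : ∀ X, Q (Hop X) = X) {A' : 𝒴} {X : 𝒳}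
    (hfix : C (A' - Hop X) = X) : N (A' - Hop X) = Q A' := by
  rw [hN, map_sub, hQH, hfix, sub_add_cancel]

/-- Hence two chart points `A′₁, A′₂` with `Q A′₁ = Q A′₂` (e.g. both in `ker Q` — the tangent space `T`) have images in
the SAME fibre of `N`; in particular the whole segment between them does (`Q` is linear). [folklore] -/
theorem fibre_of_segment {N C : 𝒴 → 𝒳} {Q : 𝒴 →ₗ[ℂ] 𝒳} {Hop : 𝒳 →ₗ[ℂ] 𝒴}
    (hN : ∀ A, N A = Q A + C A) (hQH : ∀ X, Q (Hop X) = X) {A₁ A₂ : 𝒴} (hQ : Q A₁ = Q A₂)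
    {t : ℂ} {X : 𝒳} (hfix : C ((A₁ + t • (A₂ - A₁)) - Hop X) = X) :
    N ((A₁ + t • (A₂ - A₁)) - Hop X) = Q A₁ := by
  rw [linearise_of_fixedPoint hN hQH hfix, map_add, map_smul, map_sub, hQ, sub_self, smul_zero, add_zero]

/-! ## §2 The linearising map at one chart point -/

/-- The background is the chart origin: `X = 0` is the fixed point at `A′ = 0` (`C 0 = 0` from the quadratic bound),
so `Φ(0) = 0`. [folklore] -/
theorem fixedPoint_zero {C : 𝒴 → 𝒳} {C₂ R : ℝ} (hC : QuadAnalytic C C₂ R) (hR : 0 < R) (Hop : 𝒳 →ₗ[ℂ] 𝒴) :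
    C ((0 : 𝒴) - Hop (0 : 𝒳)) = 0 := by
  rw [map_zero, sub_zero]
  have h := hC.quad 0 (by simpa using hR)
  rw [norm_zero, zero_pow two_ne_zero, mul_zero] at h
  exact norm_le_zero_iff.mp h

/-- **THE LINEARISING MAP AT ONE POINT** (B11 Prop. 3, abstract; `B13Contraction113.exists_unique_fixedPoint` +
`bound_114` BY NAME): for `‖A′‖ < ε` under the contraction condition `9C₂bε < 1` and `3ε ≤ R` there is a UNIQUE
`X⋆` in the ball `4C₂ε²` with `C (A′ − Hop X⋆) = X⋆`; the chart image `Φ(A′) := A′ − Hop X⋆` satisfies the linear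
constraint `N (Φ A′) = Q A′` and is quadratically close to `A′`: `‖Φ(A′) − A′‖ ≤ b·4C₂‖A′‖²`. [folklore] -/
theorem exists_linearising [CompleteSpace 𝒳] {N C : 𝒴 → 𝒳} {Q : 𝒴 →ₗ[ℂ] 𝒳} {Hop : 𝒳 →ₗ[ℂ] 𝒴} {C₂ R b ε : ℝ}
    (hC : QuadAnalytic C C₂ R) (hC₂ : 0 ≤ C₂) (hb : 0 ≤ b) (hHop : ∀ X, ‖Hop X‖ ≤ b * ‖X‖)
    (hN : ∀ A, N A = Q A + C A) (hQH : ∀ X, Q (Hop X) = X) (hq : 9 * C₂ * b * ε < 1) (hRC : 3 * ε ≤ R)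
    {A' : 𝒴} (hA : ‖A'‖ < ε) :
    ∃ X : 𝒳, X ∈ closedBall (0:𝒳) (4 * C₂ * ε ^ 2) ∧ C (A' - Hop X) = X ∧
      (∀ X' ∈ closedBall (0:𝒳) (4 * C₂ * ε ^ 2), C (A' - Hop X') = X' → X' = X) ∧
      N (A' - Hop X) = Q A' ∧ ‖(A' - Hop X) - A'‖ ≤ b * (4 * C₂ * ‖A'‖ ^ 2) := by
  obtain ⟨X, hX, hfix, huniq⟩ := exists_unique_fixedPoint hC hC₂ hb hHop hA hq hRC
  refine ⟨X, hX, hfix, huniq, linearise_of_fixedPoint hN hQH hfix, ?_⟩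
  have hbd := bound_114 hC hC₂ hb hHop hA hq hRC hX hfix
  rw [sub_sub_cancel_left, norm_neg]
  exact (hHop X).trans (mul_le_mul_of_nonneg_left hbd hb)

/-! ## §3 The analytic one-parameter path `σ ↦ Φ(σ • X₀)` -/

/-- **THE CHART SEGMENT IS ANALYTIC** (`B13Contraction113.analytic_fixedPoint_113` BY NAME with `A′_σ := σ • X₀`,
`H_σ := Hop`): on the disc `‖σ‖ < ρ` with `ρ‖X₀‖ < ε` there is a HOLOMORPHIC `σ ↦ X⋆(σ)` with
`C (σ•X₀ − Hop X⋆(σ)) = X⋆(σ)`, unique in the ball, `‖X⋆(σ)‖ ≤ 4C₂‖σ•X₀‖²`, and the path `Γ(σ) := σ•X₀ − Hop X⋆(σ)`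
satisfies `N (Γ σ) = σ • Q X₀` — so for `X₀ ∈ ker Q` (a tangent direction) the WHOLE PATH lies in the fibre `N = 0` of
the chart origin, and its restriction to real `t ∈ [0,1]` (inside the disc when `ρ > 1`) is the real-analytic admissible
path of `NE3EnergyAssembly.RouteLeaves`.  Hypothesis `hC'`: `C` composes holomorphically with holomorphic ball-valued
curves (true for the concrete finite-dimensional analytic `C`; stronger than `QuadAnalytic.lineAnalytic`). [folklore] -/
theorem exists_linearising_path [CompleteSpace 𝒳] {N C : 𝒴 → 𝒳} {Q : 𝒴 →ₗ[ℂ] 𝒳} {Hop : 𝒳 →ₗ[ℂ] 𝒴}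
    {C₂ R b ε ρ : ℝ} (hC : QuadAnalytic C C₂ R) (hC₂ : 0 ≤ C₂) (hb : 0 ≤ b) (hHop : ∀ X, ‖Hop X‖ ≤ b * ‖X‖)
    (hN : ∀ A, N A = Q A + C A) (hQH : ∀ X, Q (Hop X) = X) (hq : 9 * C₂ * b * ε < 1) (hRC : 3 * ε ≤ R)
    (X₀ : 𝒴) (hρ : ρ * ‖X₀‖ < ε)
    (hC' : ∀ g : ℂ → 𝒳, DifferentiableOn ℂ g (ball (0:ℂ) ρ) →
      MapsTo g (ball (0:ℂ) ρ) (closedBall (0:𝒳) (4 * C₂ * ε ^ 2)) →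
        DifferentiableOn ℂ (fun σ => C (σ • X₀ - Hop (g σ))) (ball (0:ℂ) ρ)) :
    ∃ Xs : ℂ → 𝒳, DifferentiableOn ℂ Xs (ball (0:ℂ) ρ) ∧ ∀ σ ∈ ball (0:ℂ) ρ,
      Xs σ ∈ closedBall (0:𝒳) (4 * C₂ * ε ^ 2) ∧ C (σ • X₀ - Hop (Xs σ)) = Xs σ ∧
      ‖Xs σ‖ ≤ 4 * C₂ * ‖σ • X₀‖ ^ 2 ∧ N (σ • X₀ - Hop (Xs σ)) = σ • Q X₀ := by
  have hA : ∀ σ ∈ ball (0:ℂ) ρ, ‖σ • X₀‖ < ε := by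
    intro σ hσ
    rw [mem_ball_zero_iff] at hσ
    rw [norm_smul]
    calc ‖σ‖ * ‖X₀‖ ≤ ρ * ‖X₀‖ := mul_le_mul_of_nonneg_right hσ.le (norm_nonneg _)
      _ < ε := hρ
  obtain ⟨Xs, hXd, hXs⟩ := analytic_fixedPoint_113 hC hC₂ hb isOpen_ball (Hσ := fun _ => Hop) (Aσ := fun σ => σ • X₀)
    (fun _ _ X => hHop X) hA hq hRC hC'
  refine ⟨Xs, hXd, fun σ hσ => ?_⟩
  obtain ⟨hmem, hfix, -, hbd⟩ := hXs σ hσ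
  refine ⟨hmem, hfix, hbd, ?_⟩
  rw [linearise_of_fixedPoint hN hQH hfix, map_smul]

/-- For a TANGENT direction (`Q X₀ = 0`) the analytic path stays in the fibre of the chart origin: `N (Γ σ) = 0`.
[folklore] -/
theorem path_in_fibre {N : 𝒴 → 𝒳} {Q : 𝒴 →ₗ[ℂ] 𝒳} {Hop : 𝒳 →ₗ[ℂ] 𝒴} {Xs : ℂ → 𝒳} {X₀ : 𝒴} (hQ : Q X₀ = 0)
    {σ : ℂ} (h : N (σ • X₀ - Hop (Xs σ)) = σ • Q X₀) : N (σ • X₀ - Hop (Xs σ)) = 0 := by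
  rw [h, hQ, smul_zero]

end

end Summit.QuantumFields.BalabanUV.T4Continuum.NE3Linearising
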